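import Literature.NumberTheory.EllipticCurves.CubicTwistKolyvaginClassesJZero
import Literature.NumberTheory.EllipticCurves.HeegnerPointsOfConductor
import Mathlib.FieldTheory.Galois.Infinite
import HarnessLib

/-!
# Points over an embedded extension `emb : L → K̄`: `E(L) = E(K̄)^{Gal(K̄/L)}`, the Galois actions
# match, and finite-level invariance statements pass to `Γ_K` (the bridge from Heegner/CM data over
# ring class fields to the tree's `K̄`-level Kolyvagin classes)

Kolyvagin's classes are built in the tree at the level of geometric points: `kolyvaginClass`
(`HeegnerPointsKolyvaginPrimaryClassesProofs`) takes a subgroup `A ≤ E(K̄)` and a point of `E(K̄)`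
with `Γ_K = Gal(K̄/K)`-invariant class modulo `nA`; the CM-frame layer
(`CubicTwistKolyvaginClassesJZero`) takes `A = E(K̄)^N = FixedPoints.addSubgroup N E(K̄)` for a
normal subgroup `N ≤ Γ_K`. The ARITHMETIC data, however, live over a number field: Gross 1991 §3–§4
has `y_n ∈ E(K_n)`, `P_n ∈ E(K_n)`, `𝒢_n = Gal(K_n/K)` acting, and *"`Res : H¹(K, E_p) → H¹(K_n, E_p)^{𝒢_n}`"*
((4.2)–(4.4)); in the tree `K_n = ringClassField K ι n ⊂ ℂ` with a chosen embedding
`emb : K_n → K̄` (`KolyvaginHeegnerData.emb`, bsd-stepL's `JET.KolyvaginFamilyData.emb`). This file is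
the generic bridge, for ANY `ℚ`-curve `W`, field `K` of characteristic `0`, `K`-algebra field `L` and
embedding `emb : L →+* K̄` over `K` (`hemb : emb ∘ algebraMap = algebraMap`, the tree's convention
`KolyvaginHeegnerData.emb/emb_apply`), with `ι_emb : E(L) →+ E(K̄)` any additive map agreeing with
`Affine.Point.map emb` (hypothesis `hι`; e.g. `KolyvaginHeegnerData.toGeomPoints`,
`JET.KolyvaginFamilyData.toGeomPoints`, which are `Affine.Point.map d.emb.toRatAlgHom` by definition):

* `smul_embPoints_eq_of_comp` — if `g ∈ Γ_K` restricts to `σ` on `L` (`g ∘ emb = emb ∘ σ`) then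
  `g · ι_emb(P) = ι_emb(σ P)` (Silverman VIII.§1: the actions agree); `smul_embPoints_eq_self`
  (`g` fixing `emb(L)` fixes `ι_emb(P)`); `map_toRatAlgHom_eq_pointGalHom` (dictionary with the tree's
  `pointGalHom`); `exists_algEquiv_comp_eq` (every `g` restricts to some `σ ∈ Aut(L/K)` when `L/K`
  is normal — Mathlib `AlgEquiv.restrictNormal`);
* the subgroup `N = Gal(K̄/emb L) ≤ Γ_K` enters through the characterisation
  `hN : g ∈ N ↔ g ∘ emb = emb` (`exists_subgroup_mem_iff`: Mathlib's `fixingSubgroup` of the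
  intermediate field `emb L`, `mem_fixingSubgroup_fieldRange_iff`); `normal_of_mem_iff` (it is normal
  when `L/K` is normal);
* `exists_embPoints_eq_of_forall_smul_eq` — **Galois descent** `E(K̄)^{Gal(K̄/emb L)} ⊆ ι_emb(E(L))`
  (coordinates fixed by `Gal(K̄/emb L)` lie in `emb L`: Mathlib `InfiniteGalois.fixedField_fixingSubgroup`;
  Silverman VIII.§1, proof of Prop. 1.2), hence `mem_fixedPoints_iff_exists_embPoints`:
  `Q ∈ E(K̄)^{Gal(K̄/emb L)} ↔ ∃ P, ι_emb P = Q` and `embPoints_mem_fixedPoints`;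
* `exists_subgroup_mem_iff_forall` (`N' = Gal(K̄/K(emb S))`), `exists_lift_algEquiv` (lift `σ ∈ Aut(L/K)`
  to `Γ_K`), `bijective_quotient_of_finite_level` (a transversal of `Aut(L/K)/Aut(L/K(S))` lifts to one
  of `Γ_K/N'` — the hypothesis `ht` of the `χ`-component files);
* `exists_fixedPoints_zsmul_eq_of_finite_level` — **invariance transfer**: if for every
  `σ ∈ Aut(L/K)` fixing a set `S ⊆ L` there is `a₀ ∈ E(L)` with `m a₀ = σP₀ − P₀` (printed: the class of
  the derived point `P_n` in `E(K_n)/p^M` is fixed by `Gal(K_n/L₀)`, Gross Prop. 3.6), then for every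
  `h ∈ Γ_K` fixing `emb(S)` there is `a ∈ E(K̄)^{Gal(K̄/emb L)}` with `m a = h ι_emb(P₀) − ι_emb(P₀)` —
  the hypothesis `hP` of `JZero.cubicTwist_chiComponent_fixedPoints_mem_invPoints` /
  `HuShuYin2019.exists_cmFrame_kolyvaginClass`.

Everything is proved; no definition, no named fact, no `sorry`; BSD is not claimed. (bsd-stepL's
Summits file `ClassRecordThreeEulerHalvesAtThreeKolyvaginFamilyClassCertificate` §1 proves the descent
for `JET.KolyvaginFamilyData`; this is the datum-free Literature form.)

## References

* [SilvermanAEC2009] J. H. Silverman, *The Arithmetic of Elliptic Curves*, GTM 106, VIII.§1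
  (Galois action on `E(K̄)`, `E(K̄)^{G_{K̄/L}} = E(L)`, proof of Prop. 1.2).
* [GrossLMS1991] B. H. Gross, *Kolyvagin's work on modular elliptic curves*, LMS LN 153 (1991),
  §3 (`E(K_n)`, `𝒢_n`), Prop. 3.6, §4 (4.2)–(4.4) (held PDF pp. 217–219).
* [McCallumLMS1991] W. G. McCallum, same volume, §4 (4)–(6).
-/

noncomputable section

open scoped Classical
open WeierstrassCurve

namespace Literature.NumberTheory.EllipticCurves

section EmbeddingDescent

-- `K, L : Type`: the tree's ring class fields (`ringClassField K ι n ⊂ ℂ`) and route binders live in `Type`.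
variable {K : Type} [Field K] [CharZero K] (W : WeierstrassCurve ℚ) {L : Type} [Field L] [CharZero L]
  (emb : L →+* AlgebraicClosure K)

/-- `Affine.Point.map emb` on an affine point: `(x, y) ↦ (emb x, emb y)` (definitionally), as a
geometric point of `W/K`. [folklore] -/
private theorem map_emb_some_eq {x y : L} (h : (W.baseChange L).toAffine.Nonsingular x y) :
    ∃ h' : ((W.baseChange K).baseChange (AlgebraicClosure K)).toAffine.Nonsingular (emb x) (emb y),
      @Eq (geomPoints (W.baseChange K))
        (Affine.Point.map (W' := W) emb.toRatAlgHom (Affine.Point.some x y h))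
        (Affine.Point.some (emb x) (emb y) h') :=
  ⟨_, rfl⟩

/-- The `Γ_K`-action on an affine geometric point is coordinatewise (definitionally). [folklore] -/
private theorem smul_some_eq'' (g : Field.absoluteGaloisGroup K) {x y : AlgebraicClosure K}
    (h : ((W.baseChange K).baseChange (AlgebraicClosure K)).toAffine.Nonsingular x y) :
    ∃ h', @HSMul.hSMul (Field.absoluteGaloisGroup K) (geomPoints (W.baseChange K))
        (geomPoints (W.baseChange K)) instHSMul g (Affine.Point.some x y h) =
      Affine.Point.some ((show AlgebraicClosure K ≃ₐ[K] AlgebraicClosure K from g) x)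
        ((show AlgebraicClosure K ≃ₐ[K] AlgebraicClosure K from g) y) h' :=
  ⟨_, rfl⟩

/-- **The actions agree along `emb`**: if `g ∈ Γ_K` restricts to the ring endomorphism `σ` of `L`
(`g (emb x) = emb (σ x)`), then `g · ι_emb(P) = ι_emb(σ P)` on `E(K̄)` (Silverman VIII.§1; Gross
§4: `𝒢_n` acting on `E(K_n) ⊂ E(K̄)`). [cite: SilvermanAEC2009, VIII.§1] [cite: GrossLMS1991, §4 (4.2)] -/
theorem smul_embPoints_eq_of_comp (ι : (W.baseChange L).toAffine.Point →+ geomPoints (W.baseChange K))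
    (hι : ∀ P, ι P = Affine.Point.map (W' := W) emb.toRatAlgHom P)
    (g : Field.absoluteGaloisGroup K) (σ : L →+* L)
    (hcomp : ∀ x : L, (show AlgebraicClosure K ≃ₐ[K] AlgebraicClosure K from g) (emb x) = emb (σ x))
    (P : (W.baseChange L).toAffine.Point) :
    g • ι P = ι (Affine.Point.map (W' := W) σ.toRatAlgHom P) := by
  rcases P with _ | ⟨x, y, h⟩
  · change g • ι 0 = ι (Affine.Point.map (W' := W) σ.toRatAlgHom 0)
    simp only [map_zero, smul_zero]
  · obtain ⟨h₁, e₁⟩ := map_emb_some_eq W emb h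
    obtain ⟨h₂, e₂⟩ := smul_some_eq'' W g h₁
    obtain ⟨h₃, e₃⟩ : ∃ h₃, Affine.Point.map (W' := W) σ.toRatAlgHom (Affine.Point.some x y h) =
        Affine.Point.some (σ x) (σ y) h₃ := ⟨_, rfl⟩
    obtain ⟨h₄, e₄⟩ := map_emb_some_eq W emb h₃
    refine ((congrArg (g • ·) ((hι _).trans e₁)).trans e₂).trans
      (Eq.symm (((congrArg ι e₃).trans ((hι _).trans e₄)).trans ?_))
    exact Affine.Point.some_eq_some_of_eq (hcomp x).symm (hcomp y).symm

/-- **`Gal(K̄/emb L)` fixes `ι_emb(E(L))`** (printed: `Gal(K̄/K_n)` fixes `E(K_n)`).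
[cite: SilvermanAEC2009, VIII.§1] [cite: GrossLMS1991, §4 (4.2)] -/
theorem smul_embPoints_eq_self (ι : (W.baseChange L).toAffine.Point →+ geomPoints (W.baseChange K))
    (hι : ∀ P, ι P = Affine.Point.map (W' := W) emb.toRatAlgHom P)
    (g : Field.absoluteGaloisGroup K)
    (hg : ∀ x : L, (show AlgebraicClosure K ≃ₐ[K] AlgebraicClosure K from g) (emb x) = emb x)
    (P : (W.baseChange L).toAffine.Point) : g • ι P = ι P := by
  rcases P with _ | ⟨x, y, h⟩
  · change g • ι 0 = ι 0
    simp only [map_zero, smul_zero]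
  · obtain ⟨h₁, e₁⟩ := map_emb_some_eq W emb h
    obtain ⟨h₂, e₂⟩ := smul_some_eq'' W g h₁
    refine ((congrArg (g • ·) ((hι _).trans e₁)).trans e₂).trans (Eq.symm (((hι _).trans e₁).trans ?_))
    exact Affine.Point.some_eq_some_of_eq (hg x).symm (hg y).symm

omit [CharZero K] in
/-- **Dictionary with the tree's `pointGalHom`** (the action of `Aut(K_n)` on `E(K_n)`): for
`σ ∈ Aut(L)` (e.g. `σ ∈ 𝒢_n = ringClassGal ι n`), `Affine.Point.map σ.toRatAlgHom P = pointGalHom W L σ P`,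
so `smul_embPoints_eq_of_comp` reads `g · ι_emb(P) = ι_emb(σ P)` with the tree's action.
[cite: GrossLMS1991, §4 (4.1)] -/
theorem map_toRatAlgHom_eq_pointGalHom (σ : L ≃ₐ[ℚ] L) (P : (W.baseChange L).toAffine.Point) :
    Affine.Point.map (W' := W) (σ : L →+* L).toRatAlgHom P = pointGalHom W L σ P := by
  rw [pointGalHom_apply]
  rcases P with _ | ⟨x, y, h⟩
  · rfl
  · exact Affine.Point.some_eq_some_of_eq rfl rfl

variable [Algebra K L]

omit [CharZero K] [CharZero L] in
/-- **Every `g ∈ Γ_K` restricts to `L`** when `L/K` is normal: there is `σ ∈ Aut(L/K)` with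
`g ∘ emb = emb ∘ σ` (Mathlib `AlgEquiv.restrictNormal` along `emb`). [cite: SilvermanAEC2009, VIII.§1] -/
theorem exists_algEquiv_comp_eq [Normal K L]
    (hemb : ∀ k : K, emb (algebraMap K L k) = algebraMap K (AlgebraicClosure K) k)
    (g : Field.absoluteGaloisGroup K) :
    ∃ σ : L ≃ₐ[K] L, ∀ x : L,
      (show AlgebraicClosure K ≃ₐ[K] AlgebraicClosure K from g) (emb x) = emb (σ x) := by
  letI : Algebra L (AlgebraicClosure K) := emb.toAlgebra
  haveI : IsScalarTower K L (AlgebraicClosure K) :=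
    IsScalarTower.of_algebraMap_eq fun x ↦ (hemb x).symm
  refine ⟨(show AlgebraicClosure K ≃ₐ[K] AlgebraicClosure K from g).restrictNormal L, fun x ↦ ?_⟩
  exact (AlgEquiv.restrictNormal_commutes
    (show AlgebraicClosure K ≃ₐ[K] AlgebraicClosure K from g) L x).symm

omit [CharZero K] [CharZero L] in
/-- **`Gal(K̄/emb L) ≤ Γ_K` as a Mathlib subgroup**: membership in the `fixingSubgroup` of the intermediate field `emb L`
(infinite Galois theory) is `g ∘ emb = emb` — one admissible choice of the subgroup `N` below.
[cite: SilvermanAEC2009, VIII.§1] -/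
theorem mem_fixingSubgroup_fieldRange_iff
    (hemb : ∀ k : K, emb (algebraMap K L k) = algebraMap K (AlgebraicClosure K) k)
    (g : Field.absoluteGaloisGroup K) :
    g ∈ ((AlgHom.mk emb hemb : L →ₐ[K] AlgebraicClosure K).fieldRange.fixingSubgroup :
        Subgroup (Field.absoluteGaloisGroup K)) ↔
      ∀ x : L, (show AlgebraicClosure K ≃ₐ[K] AlgebraicClosure K from g) (emb x) = emb x := by
  constructor
  · intro hg x
    exact hg ⟨emb x, (AlgHom.mem_fieldRange).mpr ⟨x, rfl⟩⟩
  · rintro hg ⟨y, hy⟩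
    obtain ⟨x, rfl⟩ := (AlgHom.mem_fieldRange).mp hy
    exact hg x

omit [CharZero K] [CharZero L] in
/-- **A subgroup `N = Gal(K̄/emb L) ≤ Γ_K` exists** with `g ∈ N ↔ g ∘ emb = emb` (the closed subgroup
of infinite Galois theory; stated as an existence so that users need not name it).
[cite: SilvermanAEC2009, VIII.§1] -/
theorem exists_subgroup_mem_iff
    (hemb : ∀ k : K, emb (algebraMap K L k) = algebraMap K (AlgebraicClosure K) k) :
    ∃ N : Subgroup (Field.absoluteGaloisGroup K), ∀ g : Field.absoluteGaloisGroup K,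
      g ∈ N ↔ ∀ x : L, (show AlgebraicClosure K ≃ₐ[K] AlgebraicClosure K from g) (emb x) = emb x :=
  ⟨_, mem_fixingSubgroup_fieldRange_iff emb hemb⟩

omit [CharZero K] [CharZero L] in
/-- **`Gal(K̄/emb L)` is normal in `Γ_K` when `L/K` is normal** (printed: `K_n/K` is Galois, so
`E(K_n) ⊂ E(K̄)` is `Γ_K`-stable), for any subgroup `N` with `g ∈ N ↔ g ∘ emb = emb`.
[cite: GrossLMS1991, §3 (𝒢_n = Gal(K_n/K))] -/
theorem normal_of_mem_iff [Normal K L]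
    (hemb : ∀ k : K, emb (algebraMap K L k) = algebraMap K (AlgebraicClosure K) k)
    (N : Subgroup (Field.absoluteGaloisGroup K))
    (hN : ∀ g : Field.absoluteGaloisGroup K,
      g ∈ N ↔ ∀ x : L, (show AlgebraicClosure K ≃ₐ[K] AlgebraicClosure K from g) (emb x) = emb x) :
    N.Normal := by
  refine ⟨fun n hn g ↦ (hN _).mpr fun x ↦ ?_⟩
  obtain ⟨σ, hσ⟩ := exists_algEquiv_comp_eq emb hemb g⁻¹
  have e2 : (show AlgebraicClosure K ≃ₐ[K] AlgebraicClosure K from n) (emb (σ x)) = emb (σ x) :=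
    (hN n).mp hn (σ x)
  have hz : ∀ z : AlgebraicClosure K, (show AlgebraicClosure K ≃ₐ[K] AlgebraicClosure K from g)
      ((show AlgebraicClosure K ≃ₐ[K] AlgebraicClosure K from g⁻¹) z) = z := fun z ↦ by
    change (show AlgebraicClosure K ≃ₐ[K] AlgebraicClosure K from g)
      ((show AlgebraicClosure K ≃ₐ[K] AlgebraicClosure K from g).symm z) = z
    exact (show AlgebraicClosure K ≃ₐ[K] AlgebraicClosure K from g).apply_symm_apply z
  change (show AlgebraicClosure K ≃ₐ[K] AlgebraicClosure K from g)
    ((show AlgebraicClosure K ≃ₐ[K] AlgebraicClosure K from n)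
      ((show AlgebraicClosure K ≃ₐ[K] AlgebraicClosure K from g⁻¹) (emb x))) = emb x
  exact (congrArg (fun z ↦ (show AlgebraicClosure K ≃ₐ[K] AlgebraicClosure K from g)
      ((show AlgebraicClosure K ≃ₐ[K] AlgebraicClosure K from n) z)) (hσ x)).trans
    ((congrArg (fun z ↦ (show AlgebraicClosure K ≃ₐ[K] AlgebraicClosure K from g) z) e2).trans
      ((congrArg (fun z ↦ (show AlgebraicClosure K ≃ₐ[K] AlgebraicClosure K from g) z)
        (hσ x).symm).trans (hz _)))

/-- **Galois descent `E(K̄)^{Gal(K̄/emb L)} ⊆ ι_emb(E(L))`**: a geometric point fixed by every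
`g ∈ Γ_K` with `g ∘ emb = emb` comes from `E(L)` (its coordinates lie in the closed intermediate
field `emb L` by infinite Galois theory, Mathlib `InfiniteGalois.fixedField_fixingSubgroup`).
Silverman VIII.§1; Gross, proof of Prop. 4.7 (1) (*"`E(K̄)^{Gal(K̄/K_n)} = E(K_n)`"*).
[cite: SilvermanAEC2009, VIII.§1 (proof of Prop. 1.2)] [cite: GrossLMS1991, Prop. 4.7 (1)] -/
theorem exists_embPoints_eq_of_forall_smul_eq
    (hemb : ∀ k : K, emb (algebraMap K L k) = algebraMap K (AlgebraicClosure K) k)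
    (ι : (W.baseChange L).toAffine.Point →+ geomPoints (W.baseChange K))
    (hι : ∀ P, ι P = Affine.Point.map (W' := W) emb.toRatAlgHom P)
    (Q : geomPoints (W.baseChange K))
    (hQ : ∀ g : Field.absoluteGaloisGroup K,
      (∀ x : L, (show AlgebraicClosure K ≃ₐ[K] AlgebraicClosure K from g) (emb x) = emb x) →
        g • Q = Q) :
    ∃ P : (W.baseChange L).toAffine.Point, ι P = Q := by
  haveI : IsGalois K (AlgebraicClosure K) := {}
  set E : IntermediateField K (AlgebraicClosure K) :=
    (AlgHom.mk emb hemb : L →ₐ[K] AlgebraicClosure K).fieldRange with hE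
  have hcoord : ∀ z : AlgebraicClosure K,
      (∀ g : AlgebraicClosure K ≃ₐ[K] AlgebraicClosure K, g ∈ E.fixingSubgroup → g z = z) →
      ∃ x : L, emb x = z := by
    intro z hz
    have hzE : z ∈ E := by
      rw [← InfiniteGalois.fixedField_fixingSubgroup E, IntermediateField.mem_fixedField_iff]
      exact fun g hg ↦ hz g hg
    obtain ⟨x, hx⟩ := (AlgHom.mem_fieldRange).mp hzE
    exact ⟨x, hx⟩
  have hfix : ∀ g : AlgebraicClosure K ≃ₐ[K] AlgebraicClosure K, g ∈ E.fixingSubgroup →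
      ∀ x : L, g (emb x) = emb x :=
    fun g hg x ↦ (mem_fixingSubgroup_fieldRange_iff emb hemb g).mp hg x
  change ((W.baseChange K).baseChange (AlgebraicClosure K)).toAffine.Point at Q
  rcases Q with _ | ⟨qx, qy, hq⟩
  · exact ⟨0, by rw [map_zero]; rfl⟩
  · have hxy : ∀ g : AlgebraicClosure K ≃ₐ[K] AlgebraicClosure K, g ∈ E.fixingSubgroup →
        g qx = qx ∧ g qy = qy := by
      intro g hg
      have h := hQ g (hfix g hg)
      obtain ⟨h', e⟩ := smul_some_eq'' W g hq
      have := e.symm.trans h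
      exact Affine.Point.some.inj this
    obtain ⟨x, hx⟩ := hcoord qx fun g hg ↦ (hxy g hg).1
    obtain ⟨y, hy⟩ := hcoord qy fun g hg ↦ (hxy g hg).2
    subst hx hy
    have hxy0 : (W.baseChange L).toAffine.Nonsingular x y :=
      (Affine.baseChange_nonsingular W emb.toRatAlgHom.injective x y).mp hq
    refine ⟨Affine.Point.some x y hxy0, ?_⟩
    rw [hι]
    rfl

/-- **`E(K̄)^N = ι_emb(E(L))` for `N = Gal(K̄/emb L)`** (any subgroup `N ≤ Γ_K` with
`g ∈ N ↔ g ∘ emb = emb`), as membership in Mathlib's `FixedPoints.addSubgroup N E(K̄)` — the subgroup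
`A = E(K_n)` of the Kolyvagin-class files. [cite: SilvermanAEC2009, VIII.§1] [cite: GrossLMS1991, §4 (4.2), Prop. 4.7 (1)] -/
theorem mem_fixedPoints_iff_exists_embPoints
    (hemb : ∀ k : K, emb (algebraMap K L k) = algebraMap K (AlgebraicClosure K) k)
    (ι : (W.baseChange L).toAffine.Point →+ geomPoints (W.baseChange K))
    (hι : ∀ P, ι P = Affine.Point.map (W' := W) emb.toRatAlgHom P)
    (N : Subgroup (Field.absoluteGaloisGroup K))
    (hN : ∀ g : Field.absoluteGaloisGroup K,
      g ∈ N ↔ ∀ x : L, (show AlgebraicClosure K ≃ₐ[K] AlgebraicClosure K from g) (emb x) = emb x)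
    (Q : geomPoints (W.baseChange K)) :
    Q ∈ FixedPoints.addSubgroup N (geomPoints (W.baseChange K)) ↔
      ∃ P : (W.baseChange L).toAffine.Point, ι P = Q := by
  rw [JZero.mem_fixedPoints_iff]
  constructor
  · intro hQ
    exact exists_embPoints_eq_of_forall_smul_eq W emb hemb ι hι Q fun g hg ↦ hQ g ((hN g).mpr hg)
  · rintro ⟨P, rfl⟩ g hg
    exact smul_embPoints_eq_self W emb ι hι g ((hN g).mp hg) P

omit [Algebra K L] in
/-- `ι_emb(P) ∈ E(K̄)^N`. [cite: SilvermanAEC2009, VIII.§1] -/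
theorem embPoints_mem_fixedPoints
    (ι : (W.baseChange L).toAffine.Point →+ geomPoints (W.baseChange K))
    (hι : ∀ P, ι P = Affine.Point.map (W' := W) emb.toRatAlgHom P)
    (N : Subgroup (Field.absoluteGaloisGroup K))
    (hN : ∀ g : Field.absoluteGaloisGroup K,
      g ∈ N ↔ ∀ x : L, (show AlgebraicClosure K ≃ₐ[K] AlgebraicClosure K from g) (emb x) = emb x)
    (P : (W.baseChange L).toAffine.Point) :
    ι P ∈ FixedPoints.addSubgroup N (geomPoints (W.baseChange K)) :=
  (JZero.mem_fixedPoints_iff _ N _).mpr fun g hg ↦ smul_embPoints_eq_self W emb ι hι g ((hN g).mp hg) P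

/-- **Invariance transfer from the finite level** (`L/K` normal): if for every `σ ∈ Aut(L/K)` fixing
a set `S ⊆ L` (printed: `σ ∈ Gal(K_n/L₀)`) there is `a₀ ∈ E(L)` with `m a₀ = σP₀ − P₀` (the class of
`P₀` in `E(L)/mE(L)` is `Gal(L/L₀)`-invariant — Gross Prop. 3.6 for the derived point), then for every
`h ∈ Γ_K` fixing `emb(S)` there is `a ∈ E(K̄)^N` with `m a = h ι_emb(P₀) − ι_emb(P₀)`: the `K̄`-level
hypothesis `hP` of `JZero.cubicTwist_chiComponent_fixedPoints_mem_invPoints` /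
`HuShuYin2019.exists_cmFrame_kolyvaginClass` (with `N'` the subgroup fixing `emb(S)`).
[cite: GrossLMS1991, Prop. 3.6, §4 (4.1)] [cite: McCallumLMS1991, §4 (4)] -/
theorem exists_fixedPoints_zsmul_eq_of_finite_level [Normal K L]
    (hemb : ∀ k : K, emb (algebraMap K L k) = algebraMap K (AlgebraicClosure K) k)
    (ι : (W.baseChange L).toAffine.Point →+ geomPoints (W.baseChange K))
    (hι : ∀ P, ι P = Affine.Point.map (W' := W) emb.toRatAlgHom P)
    (N : Subgroup (Field.absoluteGaloisGroup K))
    (hN : ∀ g : Field.absoluteGaloisGroup K,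
      g ∈ N ↔ ∀ x : L, (show AlgebraicClosure K ≃ₐ[K] AlgebraicClosure K from g) (emb x) = emb x)
    (P₀ : (W.baseChange L).toAffine.Point) (m : ℤ) (S : Set L)
    (hfin : ∀ σ : L ≃ₐ[K] L, (∀ x ∈ S, σ x = x) →
      ∃ a₀ : (W.baseChange L).toAffine.Point,
        m • a₀ = Affine.Point.map (W' := W) (σ : L →+* L).toRatAlgHom P₀ - P₀)
    (h : Field.absoluteGaloisGroup K)
    (hh : ∀ x ∈ S, (show AlgebraicClosure K ≃ₐ[K] AlgebraicClosure K from h) (emb x) = emb x) :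
    ∃ a ∈ FixedPoints.addSubgroup N (geomPoints (W.baseChange K)), m • a = h • ι P₀ - ι P₀ := by
  obtain ⟨σ, hσ⟩ := exists_algEquiv_comp_eq emb hemb h
  have hσS : ∀ x ∈ S, σ x = x := by
    intro x hx
    apply emb.injective
    rw [← hσ x]
    exact hh x hx
  obtain ⟨a₀, ha₀⟩ := hfin σ hσS
  refine ⟨ι a₀, embPoints_mem_fixedPoints W emb ι hι N hN a₀, ?_⟩
  rw [← map_zsmul, ha₀, map_sub, smul_embPoints_eq_of_comp W emb ι hι h (σ : L →+* L) hσ P₀]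

omit [CharZero K] [CharZero L] [Algebra K L] in
/-- **The subgroup `N' = Gal(K̄/K(emb S)) ≤ Γ_K` of elements fixing `emb(S)`** exists with
`g ∈ N' ↔ ∀ x ∈ S, g (emb x) = emb x` (Mathlib `fixingSubgroup` of the set `emb '' S`; printed:
`Gal(K̄/L₀)` for a subfield `L₀ = K(S)`, e.g. `L₀ = K(∛c)` in the CM frame). [cite: SilvermanAEC2009, VIII.§1] -/
theorem exists_subgroup_mem_iff_forall (S : Set L) :
    ∃ N' : Subgroup (Field.absoluteGaloisGroup K), ∀ g : Field.absoluteGaloisGroup K,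
      g ∈ N' ↔ ∀ x ∈ S, (show AlgebraicClosure K ≃ₐ[K] AlgebraicClosure K from g) (emb x) = emb x := by
  refine ⟨fixingSubgroup (AlgebraicClosure K ≃ₐ[K] AlgebraicClosure K) ((emb : L → AlgebraicClosure K) '' S),
    fun g ↦ ⟨fun hg x hx ↦ hg ⟨emb x, x, hx, rfl⟩, ?_⟩⟩
  rintro hg ⟨y, x, hx, rfl⟩
  exact hg x hx

omit [CharZero K] [CharZero L] in
/-- **Every `σ ∈ Aut(L/K)` lifts to `Γ_K`** when `L/K` is normal: there is `g ∈ Γ_K` with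
`g ∘ emb = emb ∘ σ` (Mathlib `AlgEquiv.restrictNormalHom_surjective`; printed: lift `σ ∈ 𝒢_n` to
`Gal(K̄/K)`). [cite: GrossLMS1991, §4 (4.2)] -/
theorem exists_lift_algEquiv [Normal K L]
    (hemb : ∀ k : K, emb (algebraMap K L k) = algebraMap K (AlgebraicClosure K) k)
    (σ : L ≃ₐ[K] L) :
    ∃ g : Field.absoluteGaloisGroup K, ∀ x : L, (show AlgebraicClosure K ≃ₐ[K] AlgebraicClosure K from g) (emb x) = emb (σ x) := by
  letI : Algebra L (AlgebraicClosure K) := emb.toAlgebra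
  haveI : IsScalarTower K L (AlgebraicClosure K) :=
    IsScalarTower.of_algebraMap_eq fun x ↦ (hemb x).symm
  obtain ⟨g, hg⟩ := AlgEquiv.restrictNormalHom_surjective (F := K) (K₁ := L)
    (E := AlgebraicClosure K) σ
  refine ⟨g, fun x ↦ ?_⟩
  have h := AlgEquiv.restrictNormal_commutes g L x
  change emb (g.restrictNormal L x) = g (emb x) at h
  change g (emb x) = emb (σ x)
  rw [← h, ← hg]
  rfl

omit [CharZero K] [CharZero L] in
/-- **Transversals transfer from the finite level**: if `τ : ι → Aut(L/K)` is a system of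
representatives of `Aut(L/K)/H`, `H = {σ : σ|_S = id}` (printed: of `Gal(L/K)/Gal(L/L₀)
= Gal(L₀/K)`, e.g. `Gal(K(∛c)/K) ≅ ℤ/3`), and `t i ∈ Γ_K` lifts `τ i` along `emb`, then `t` is a
system of representatives of `Γ_K/N'`, `N' = {g : g|_{emb S} = id}` — the hypothesis `ht` of
`KolyvaginCocycle.chiComponent_isotypic` / `HuShuYin2019.exists_cmFrame_kolyvaginClass`.
[cite: GrossLMS1991, §3 (3.3)–(3.4)] -/
theorem bijective_quotient_of_finite_level [Normal K L]
    (hemb : ∀ k : K, emb (algebraMap K L k) = algebraMap K (AlgebraicClosure K) k)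
    (S : Set L) (N' : Subgroup (Field.absoluteGaloisGroup K))
    (hN' : ∀ g : Field.absoluteGaloisGroup K, g ∈ N' ↔ ∀ x ∈ S, (show AlgebraicClosure K ≃ₐ[K] AlgebraicClosure K from g) (emb x) = emb x)
    (H : Subgroup (L ≃ₐ[K] L)) (hH : ∀ σ : L ≃ₐ[K] L, σ ∈ H ↔ ∀ x ∈ S, σ x = x)
    {ι : Type*} (τ : ι → (L ≃ₐ[K] L)) (hτ : Function.Bijective fun i ↦ (τ i : (L ≃ₐ[K] L) ⧸ H))
    (t : ι → Field.absoluteGaloisGroup K) (ht : ∀ i (x : L), (show AlgebraicClosure K ≃ₐ[K] AlgebraicClosure K from t i) (emb x) = emb (τ i x)) :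
    Function.Bijective fun i ↦ (t i : Field.absoluteGaloisGroup K ⧸ N') := by
  constructor
  · intro i j hij
    have hij' : (t i : Field.absoluteGaloisGroup K ⧸ N') = t j := hij
    have hmem : (t i)⁻¹ * t j ∈ N' := QuotientGroup.eq.mp hij'
    apply hτ.1
    change (τ i : (L ≃ₐ[K] L) ⧸ H) = τ j
    refine QuotientGroup.eq.mpr ((hH _).mpr fun x hx ↦ ?_)
    have h1 := (hN' _).mp hmem x hx
    have e := congrArg (show AlgebraicClosure K ≃ₐ[K] AlgebraicClosure K from t i) h1
    have e' : (show AlgebraicClosure K ≃ₐ[K] AlgebraicClosure K from t i) ((show AlgebraicClosure K ≃ₐ[K] AlgebraicClosure K from t i).symm ((show AlgebraicClosure K ≃ₐ[K] AlgebraicClosure K from t j) (emb x))) = (show AlgebraicClosure K ≃ₐ[K] AlgebraicClosure K from t j) (emb x) :=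
      (show AlgebraicClosure K ≃ₐ[K] AlgebraicClosure K from t i).apply_symm_apply _
    have h2 : (show AlgebraicClosure K ≃ₐ[K] AlgebraicClosure K from t j) (emb x) = (show AlgebraicClosure K ≃ₐ[K] AlgebraicClosure K from t i) (emb x) := e'.symm.trans e
    have h3 : τ j x = τ i x := emb.injective ((ht j x).symm.trans (h2.trans (ht i x)))
    change (τ i).symm (τ j x) = x
    rw [h3]
    exact (τ i).symm_apply_apply x
  · intro q
    obtain ⟨g, rfl⟩ := QuotientGroup.mk_surjective q
    obtain ⟨σ, hσ⟩ := exists_algEquiv_comp_eq emb hemb g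
    obtain ⟨i, hi⟩ := hτ.2 (σ : (L ≃ₐ[K] L) ⧸ H)
    have hmem : (τ i)⁻¹ * σ ∈ H := QuotientGroup.eq.mp hi
    refine ⟨i, ?_⟩
    change (t i : Field.absoluteGaloisGroup K ⧸ N') = g
    refine QuotientGroup.eq.mpr ((hN' _).mpr fun x hx ↦ ?_)
    have h1 : σ x = τ i x := by
      have h0 := (hH _).mp hmem x hx
      change (τ i).symm (σ x) = x at h0
      have := congrArg (τ i) h0
      rwa [AlgEquiv.apply_symm_apply] at this
    change (show AlgebraicClosure K ≃ₐ[K] AlgebraicClosure K from t i).symm ((show AlgebraicClosure K ≃ₐ[K] AlgebraicClosure K from g) (emb x)) = emb x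
    rw [hσ x, h1, ← ht i x]
    exact (show AlgebraicClosure K ≃ₐ[K] AlgebraicClosure K from t i).symm_apply_apply (emb x)

end EmbeddingDescent

end Literature.NumberTheory.EllipticCurves
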